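import Summits.AtomisticToContinuum.Crystallization.Theorems.FluxCellKepler.Negative.Pricing

/-!
# `FluxCellKepler` (stmt-AtomisticToContinuum-15221), line `Sketch` — block patterns and block
# energies of a periodic configuration against its lattice sums

Helper file (part 1 of 2) of the lead prover (continuation c2) of crux
`FluxTubeKepler.FluxCellKepler` for the periodic over-credit window / exactness theorem
(`FluxTubeKeplerFluxCellKeplerWitnessExactness.lean`).  For a periodic configuration `Q` of `ℝ³`:

* `bulkPat Q R₁ y` — the `R₁`-pattern of a point `y` of `Q` (relative positions of the points of
  `Q` within `R₁`), translation invariant along periods; `bulkCredit Q R₁ τ = Σ_{m ∈ F} τ (bulkPat m)`;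
* `pat_block_eq_bulkPat` — a `(depth (R₁+1))`-deep site of the block `blockConfig Q K` is fed
  exactly its bulk pattern (`exists_eq_toP_of_dist_lt`);
* `exists_bound_tau_pat` — block patterns are subsets of ONE finite universe of relative positions
  (lattice coordinates differ by at most `depth R₁`, `abs_coords_sub_le`), so any `τ` is bounded on
  them uniformly in `K`;
* `sum_siteEnergy_six_block`, `sum_siteEnergy_twelve_block_le`, `two_mul_card_mul_energyPerParticle`
  — block `r⁻⁶` site energies are `K³ S₆(Q) − Σ tails`, block `r⁻¹²` site energies are at most
  `K³ S₁₂(Q)`, and `2 #F e(Q) = S₁₂/12 − S₆/6`;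
* `sum_tau_pat_block_eq`, `abs_sum_boundary_le` — the pattern sum of a block is
  `#deep · bulkCredit + boundary`, `|boundary| ≤ M · #F · 6 depth · K²`.

All `[folklore]`; tree facts only (block machinery of `ChargedEnergyGap/Negative`).
-/
noncomputable section

namespace Summit.AtomisticToContinuum.Crystallization.Theorems.FluxCellKeplerSketchExact

open scoped BigOperators
open Literature.MathematicalPhysics.StatisticalMechanics
open Summit.AtomisticToContinuum.Crystallization.Theses.FluxTubeKepler
open Summit.AtomisticToContinuum.Crystallization.Theorems.ChargedEnergyGapNegative
open Summit.AtomisticToContinuum.Crystallization.Theorems.ChargedEnergyGapNegative.Blocks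
open Summit.AtomisticToContinuum.Crystallization.Theorems.FluxCellKepler

/-! ## Patterns -/

/-- The `R₁`-pattern of site `i` of a finite configuration (the argument of `τ` in the crux,
verbatim). [folklore] -/
def pat (R₁ : ℝ) {N : ℕ} (x : Fin N → E3) (i : Fin N) : Finset E3 :=
  (Finset.univ.filter fun j : Fin N => dist (x j) (x i) ≤ R₁).image fun j => x j - x i

/-- The BULK `R₁`-pattern of a point `y` of a periodic configuration `Q`: the relative positions
of the points of `Q` within distance `R₁` of `y` (finitely many: `finite_inter_points`).
[folklore] -/
def bulkPat (Q : PeriodicConfiguration 3) (R₁ : ℝ) (y : E3) : Finset E3 :=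
  (Q.finite_inter_points (Metric.isBounded_closedBall (x := y) (r := R₁))).toFinset.image
    fun p => p - y

/-- Membership in the bulk pattern. [folklore] -/
theorem mem_bulkPat {Q : PeriodicConfiguration 3} {R₁ : ℝ} {y v : E3} :
    v ∈ bulkPat Q R₁ y ↔ y + v ∈ Q.points ∧ ‖v‖ ≤ R₁ := by
  unfold bulkPat
  simp only [Finset.mem_image, Set.Finite.mem_toFinset, Set.mem_inter_iff, Metric.mem_closedBall]
  constructor
  · rintro ⟨p, ⟨hp, hpQ⟩, rfl⟩
    refine ⟨by simpa using hpQ, ?_⟩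
    rwa [dist_eq_norm] at hp
  · rintro ⟨hv, hvR⟩
    exact ⟨y + v, ⟨by rwa [dist_eq_norm, add_sub_cancel_left], hv⟩, add_sub_cancel_left y v⟩

/-- Translation invariance of the bulk pattern along periods. [folklore] -/
theorem bulkPat_add (Q : PeriodicConfiguration 3) (R₁ : ℝ) {y g : E3} (hg : g ∈ Q.lattice) :
    bulkPat Q R₁ (y + g) = bulkPat Q R₁ y := by
  ext v
  rw [mem_bulkPat, mem_bulkPat, add_right_comm, Q.add_mem_points_iff hg]

/-- In particular at block points. [folklore] -/
theorem bulkPat_bpt (Q : PeriodicConfiguration 3) (K : ℕ) (R₁ : ℝ) (u : BIdx Q K) :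
    bulkPat Q R₁ (bpt Q K u) = bulkPat Q R₁ u.1 :=
  bulkPat_add Q R₁ (latVec_mem Q _)

/-- The credit of one period: `T_Q = Σ_{m ∈ F} τ (bulkPat Q R₁ m)`. [folklore] -/
def bulkCredit (Q : PeriodicConfiguration 3) (R₁ : ℝ) (τ : Finset E3 → ℝ) : ℝ :=
  ∑ m ∈ Q.motif, τ (bulkPat Q R₁ m)

/-! ## Block patterns: deep sites see their bulk pattern -/

section Blocks

variable (Q : PeriodicConfiguration 3) (K : ℕ) (R₁ : ℝ)

/-- The block configuration evaluated at the index of `u` is the block point of `u`. [folklore] -/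
theorem blockConfig_equivFin (u : BIdx Q K) :
    blockConfig Q K (Fintype.equivFin (BIdx Q K) u) = bpt Q K u := by
  rw [blockConfig_apply, Equiv.symm_apply_apply]

/-- **Deep block sites are fed their bulk pattern**: for a `(depth (R₁+1))`-deep block index `u`
the `R₁`-pattern of the block at `u` is `bulkPat Q R₁ (bpt u)`. [folklore] -/
theorem pat_block_eq_bulkPat {u : BIdx Q K} (hdeep : IsDeep K (depth Q (R₁ + 1)) u.2) :
    pat R₁ (blockConfig Q K) (Fintype.equivFin (BIdx Q K) u) = bulkPat Q R₁ (bpt Q K u) := by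
  classical
  ext v
  rw [mem_bulkPat]
  unfold pat
  simp only [Finset.mem_image, Finset.mem_filter, Finset.mem_univ, true_and,
    blockConfig_equivFin]
  constructor
  · rintro ⟨j, hj, rfl⟩
    refine ⟨?_, ?_⟩
    · rw [add_sub_cancel, blockConfig_apply]
      exact bpt_mem Q K _
    · rwa [← dist_eq_norm]
  · rintro ⟨hv, hvR⟩
    by_cases hv0 : v = 0
    · refine ⟨Fintype.equivFin (BIdx Q K) u, ?_, ?_⟩
      · rw [blockConfig_equivFin, dist_self]
        exact (norm_nonneg v).trans hvR
      · rw [blockConfig_equivFin, sub_self, hv0]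
    · have hne : (⟨bpt Q K u + v, hv⟩ : Q.points) ≠ toP Q K u := by
        intro h
        have h' := congrArg Subtype.val h
        simp only [val_toP] at h'
        exact hv0 (by simpa using h')
      have hlt : dist (bpt Q K u) (bpt Q K u + v) < R₁ + 1 := by
        rw [dist_comm, dist_eq_norm, add_sub_cancel_left]
        linarith
      obtain ⟨w, -, hw⟩ := exists_eq_toP_of_dist_lt Q K hdeep ⟨bpt Q K u + v, hv⟩ hne hlt
      have hw' : bpt Q K w = bpt Q K u + v := congrArg Subtype.val hw
      refine ⟨Fintype.equivFin (BIdx Q K) w, ?_, ?_⟩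
      · rw [blockConfig_equivFin, hw', dist_eq_norm, add_sub_cancel_left]
        exact hvR
      · rw [blockConfig_equivFin, hw', add_sub_cancel_left]

/-! ## Block patterns come from a finite list: `τ` is bounded on them uniformly in `K` -/

/-- The finite universe of relative positions that can occur in an `R₁`-pattern of a block site:
`m' − m + latVec c` with `m, m' ∈ F` and integer coordinates `|cᵢ| ≤ depth R₁`. [folklore] -/
def patUniverse : Finset E3 :=
  ((Q.motif ×ˢ Q.motif) ×ˢ Fintype.piFinset fun _ : Fin 3 =>
      Finset.Icc (-(depth Q R₁ : ℤ)) (depth Q R₁)).image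
    fun p => p.1.1 - p.1.2 + latVec Q p.2

/-- Every `R₁`-pattern of a block site is a subset of the universe. [folklore] -/
theorem pat_block_subset (i : Fin (Fintype.card (BIdx Q K))) :
    pat R₁ (blockConfig Q K) i ⊆ patUniverse Q R₁ := by
  classical
  intro v hv
  unfold pat at hv
  simp only [Finset.mem_image, Finset.mem_filter, Finset.mem_univ, true_and] at hv
  obtain ⟨j, hj, rfl⟩ := hv
  set u := (Fintype.equivFin (BIdx Q K)).symm i with hu
  set w := (Fintype.equivFin (BIdx Q K)).symm j with hw
  rw [blockConfig_apply, blockConfig_apply] at hj ⊢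
  rw [← hu, ← hw] at hj ⊢
  unfold patUniverse
  simp only [Finset.mem_image, Finset.mem_product, Fintype.mem_piFinset, Finset.mem_Icc]
  refine ⟨((w.1.1, u.1.1), coords K w.2 - coords K u.2), ⟨⟨w.1.2, u.1.2⟩, fun a => ?_⟩, ?_⟩
  · have hb := abs_coords_sub_le Q K w u a
    have hceil : coordBound Q * (R₁ + 2 * motifSize Q) ≤ (depth Q R₁ : ℝ) := Nat.le_ceil _
    have hΛ := coordBound_nonneg Q
    have hle : |((coords K w.2 a : ℤ) : ℝ) - ((coords K u.2 a : ℤ) : ℝ)| ≤ (depth Q R₁ : ℝ) :=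
      hb.trans ((mul_le_mul_of_nonneg_left (by linarith) hΛ).trans hceil)
    have hle' : |(coords K w.2 a - coords K u.2 a : ℤ)| ≤ (depth Q R₁ : ℤ) := by
      have : (|(coords K w.2 a - coords K u.2 a : ℤ)| : ℝ) ≤ ((depth Q R₁ : ℤ) : ℝ) := by
        push_cast; exact hle
      exact_mod_cast this
    simp only [Pi.sub_apply]
    exact abs_le.1 hle'
  · simp only [bpt, latVec_sub]
    abel

/-- **`τ` is bounded on block patterns, uniformly in the block size.** [folklore] -/
theorem exists_bound_tau_pat (τ : Finset E3 → ℝ) :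
    ∃ M : ℝ, 0 ≤ M ∧ ∀ (K : ℕ) (i : Fin (Fintype.card (BIdx Q K))),
      |τ (pat R₁ (blockConfig Q K) i)| ≤ M := by
  classical
  refine ⟨∑ S ∈ (patUniverse Q R₁).powerset, |τ S|,
    Finset.sum_nonneg fun _ _ => abs_nonneg _, fun K i => ?_⟩
  exact Finset.single_le_sum (f := fun S => |τ S|) (fun _ _ => abs_nonneg _)
    (Finset.mem_powerset.2 (pat_block_subset Q K R₁ i))

end Blocks

/-! ## Block energies against lattice sums -/

section Energies

variable (Q : PeriodicConfiguration 3) (K : ℕ)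

/-- The inverse twelfth power as a "potential". [folklore] -/
def twelve : ℝ → ℝ := fun r => r⁻¹ ^ 12

/-- `twelve ≥ 0`. [folklore] -/
theorem twelve_nonneg (r : ℝ) : 0 ≤ twelve r := by
  unfold twelve; positivity

/-- The inverse-twelfth-power lattice sum at `p` is summable (`d = 3 < 12`). [folklore] -/
theorem summable_twelve (p : E3) :
    Summable fun q : {q : E3 // q ∈ Q.points ∧ q ≠ p} => twelve (dist p q.1) :=
  Q.summable_inv_pow_dist (by norm_num) p

/-- Sum of the full twelfth-power site sums over the motif. [folklore] -/
def twelveSum : ℝ := ∑ x ∈ Q.motif, siteSum Q twelve x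

/-- The Lennard-Jones lattice sum splits: `siteSum V_LJ = (1/12) siteSum r⁻¹² − (1/6) siteSum r⁻⁶`.
[folklore] -/
theorem siteSum_lennardJones_eq (p : E3) :
    siteSum Q lennardJones p =
      (1 / 12 : ℝ) * siteSum Q twelve p - (1 / 6 : ℝ) * siteSum Q six p := by
  unfold siteSum
  rw [← tsum_mul_left, ← tsum_mul_left, ← ((summable_twelve Q p).mul_left (1 / 12)).tsum_sub
    ((summable_six Q p).mul_left (1 / 6))]
  rfl

/-- `2 #F e(Q) = (1/12) S₁₂(Q) − (1/6) S₆(Q)`. [folklore] -/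
theorem two_mul_card_mul_energyPerParticle :
    2 * Q.motif.card * Q.energyPerParticle lennardJones =
      (1 / 12 : ℝ) * twelveSum Q - (1 / 6 : ℝ) * sixSum Q := by
  rw [← sum_siteSum_eq, Finset.sum_congr rfl fun p _ => siteSum_lennardJones_eq Q p,
    Finset.sum_sub_distrib, ← Finset.mul_sum, ← Finset.mul_sum]
  rfl

/-- Site energies of the block configuration as sums over the other block indices
(for a "potential" with `V 0 = 0`). [folklore] -/
theorem siteEnergy_block (V : ℝ → ℝ) (hV : V 0 = 0) (u : BIdx Q K) :
    siteEnergy V (blockConfig Q K) (Fintype.equivFin (BIdx Q K) u) =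
      ∑ v ∈ Finset.univ.erase u, V (dist (bpt Q K u) (bpt Q K v)) := by
  classical
  have h1 : siteEnergy V (blockConfig Q K) (Fintype.equivFin (BIdx Q K) u) =
      ∑ j, V (dist (bpt Q K u) (blockConfig Q K j)) := by
    unfold siteEnergy
    rw [← Finset.add_sum_erase Finset.univ _ (Finset.mem_univ (Fintype.equivFin (BIdx Q K) u)),
      blockConfig_equivFin, dist_self, hV, zero_add]
  have h2 : ∑ j, V (dist (bpt Q K u) (blockConfig Q K j)) =
      ∑ v : BIdx Q K, V (dist (bpt Q K u) (bpt Q K v)) := by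
    rw [← (Fintype.equivFin (BIdx Q K)).sum_comp]
    simp only [blockConfig_equivFin]
  rw [h1, h2, ← Finset.add_sum_erase Finset.univ _ (Finset.mem_univ u), dist_self, hV, zero_add]

/-- The block `r⁻⁶` site energy at `u` is the lattice sum minus the tail. [folklore] -/
theorem siteEnergy_six_block (u : BIdx Q K) :
    siteEnergy (fun r => (r⁻¹) ^ 6) (blockConfig Q K) (Fintype.equivFin (BIdx Q K) u) =
      siteSum Q six u.1 - tailSix Q K u := by
  have h := siteEnergy_block Q K six (by norm_num [six]) u
  have hsplit : siteSum Q six (bpt Q K u) =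
      ∑ v ∈ Finset.univ.erase u, six (dist (bpt Q K u) (bpt Q K v)) + tailSix Q K u := by
    unfold siteSum tailSix
    rw [← sum_blockOthers, (summable_six Q (bpt Q K u)).sum_add_tsum_compl]
  rw [siteSum_bpt] at hsplit
  change siteEnergy six (blockConfig Q K) _ = _
  linarith

/-- The block `r⁻¹²` site energy at `u` is at most the lattice sum. [folklore] -/
theorem siteEnergy_twelve_block_le (u : BIdx Q K) :
    siteEnergy (fun r => (r⁻¹) ^ 12) (blockConfig Q K) (Fintype.equivFin (BIdx Q K) u) ≤
      siteSum Q twelve u.1 := by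
  have h := siteEnergy_block Q K twelve (by norm_num [twelve]) u
  have hle : ∑ v ∈ Finset.univ.erase u, twelve (dist (bpt Q K u) (bpt Q K v)) ≤
      siteSum Q twelve (bpt Q K u) := by
    unfold siteSum
    rw [← sum_blockOthers]
    exact (summable_twelve Q (bpt Q K u)).sum_le_tsum _ fun q _ => twelve_nonneg _
  rw [siteSum_bpt] at hle
  change siteEnergy twelve (blockConfig Q K) _ ≤ _
  linarith

/-- **Sum of the block `r⁻⁶` site energies**: `Σ_i site₆ = K³ S₆(Q) − Σ_u tailSix u`.
[folklore] -/
theorem sum_siteEnergy_six_block :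
    ∑ i, siteEnergy (fun r => (r⁻¹) ^ 6) (blockConfig Q K) i =
      (K : ℝ) ^ 3 * sixSum Q - ∑ u : BIdx Q K, tailSix Q K u := by
  rw [← (Fintype.equivFin (BIdx Q K)).sum_comp]
  simp only [siteEnergy_six_block, Finset.sum_sub_distrib]
  congr 1
  rw [Fintype.sum_prod_type]
  simp only [Finset.sum_const, Finset.card_univ, Fintype.card_fun, Fintype.card_fin, nsmul_eq_mul]
  unfold sixSum
  rw [Finset.mul_sum, ← Finset.sum_coe_sort Q.motif (fun x => (K : ℝ) ^ 3 * siteSum Q six x)]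
  push_cast
  rfl

/-- **Sum of the block `r⁻¹²` site energies**: `Σ_i site₁₂ ≤ K³ S₁₂(Q)`. [folklore] -/
theorem sum_siteEnergy_twelve_block_le :
    ∑ i, siteEnergy (fun r => (r⁻¹) ^ 12) (blockConfig Q K) i ≤ (K : ℝ) ^ 3 * twelveSum Q := by
  rw [← (Fintype.equivFin (BIdx Q K)).sum_comp]
  calc ∑ u : BIdx Q K, siteEnergy (fun r => (r⁻¹) ^ 12) (blockConfig Q K)
        (Fintype.equivFin (BIdx Q K) u)
      ≤ ∑ u : BIdx Q K, siteSum Q twelve u.1 :=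
        Finset.sum_le_sum fun u _ => siteEnergy_twelve_block_le Q K u
    _ = (K : ℝ) ^ 3 * twelveSum Q := by
        rw [Fintype.sum_prod_type]
        simp only [Finset.sum_const, Finset.card_univ, Fintype.card_fun, Fintype.card_fin,
          nsmul_eq_mul]
        unfold twelveSum
        rw [Finset.mul_sum, ← Finset.sum_coe_sort Q.motif (fun x => (K : ℝ) ^ 3 * siteSum Q twelve x)]
        push_cast
        rfl

end Energies

/-! ## The pattern sum of a block: deep part `#deep · T_Q`, bounded boundary part -/

section PatternSum

variable (Q : PeriodicConfiguration 3) (K : ℕ) (R₁ : ℝ)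

/-- Filtering a product type on the second coordinate. [folklore] -/
theorem filter_snd_eq {α β : Type*} [Fintype α] [Fintype β] (p : β → Prop) [DecidablePred p] :
    (Finset.univ.filter fun u : α × β => p u.2) = (Finset.univ : Finset α) ×ˢ
      (Finset.univ.filter p) := by
  ext u
  simp

/-- **The pattern sum of a block**: the `(depth (R₁+1))`-deep sites contribute
`#deep · T_Q`, the rest is the boundary part. [folklore] -/
theorem sum_tau_pat_block_eq (τ : Finset E3 → ℝ) :
    ∑ i, τ (pat R₁ (blockConfig Q K) i) =
      (Nat.card {k : Fin 3 → Fin K // IsDeep K (depth Q (R₁ + 1)) k} : ℝ) * bulkCredit Q R₁ τ +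
      ∑ u ∈ Finset.univ.filter (fun u : BIdx Q K => ¬ IsDeep K (depth Q (R₁ + 1)) u.2),
        τ (pat R₁ (blockConfig Q K) (Fintype.equivFin (BIdx Q K) u)) := by
  classical
  rw [← (Fintype.equivFin (BIdx Q K)).sum_comp, ← Finset.sum_filter_add_sum_filter_not
    Finset.univ (fun u : BIdx Q K => IsDeep K (depth Q (R₁ + 1)) u.2)]
  congr 1
  have h1 : ∑ u ∈ Finset.univ.filter (fun u : BIdx Q K => IsDeep K (depth Q (R₁ + 1)) u.2),
      τ (pat R₁ (blockConfig Q K) (Fintype.equivFin (BIdx Q K) u)) =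
      ∑ u ∈ Finset.univ.filter (fun u : BIdx Q K => IsDeep K (depth Q (R₁ + 1)) u.2),
        τ (bulkPat Q R₁ (u.1 : E3)) := by
    refine Finset.sum_congr rfl fun u hu => ?_
    rw [pat_block_eq_bulkPat Q K R₁ (Finset.mem_filter.1 hu).2, bulkPat_bpt]
  rw [h1, filter_snd_eq, Finset.sum_product, Finset.sum_comm]
  simp only [Finset.sum_const]
  rw [nsmul_eq_mul, Nat.card_eq_fintype_card, Fintype.card_subtype]
  congr 1
  unfold bulkCredit
  exact Finset.sum_coe_sort Q.motif (fun m => τ (bulkPat Q R₁ m))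

/-- The boundary part is bounded by `M · #F · 6 depth(R₁+1) · K²`. [folklore] -/
theorem abs_sum_boundary_le (τ : Finset E3 → ℝ) {M : ℝ} (hM0 : 0 ≤ M)
    (hM : ∀ (K : ℕ) (i : Fin (Fintype.card (BIdx Q K))), |τ (pat R₁ (blockConfig Q K) i)| ≤ M) :
    |∑ u ∈ Finset.univ.filter (fun u : BIdx Q K => ¬ IsDeep K (depth Q (R₁ + 1)) u.2),
        τ (pat R₁ (blockConfig Q K) (Fintype.equivFin (BIdx Q K) u))| ≤
      M * (Q.motif.card * (6 * (depth Q (R₁ + 1)) * (K : ℝ) ^ 2)) := by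
  classical
  refine (Finset.abs_sum_le_sum_abs _ _).trans ?_
  refine (Finset.sum_le_sum fun u _ => hM K _).trans ?_
  rw [Finset.sum_const, nsmul_eq_mul, mul_comm]
  refine mul_le_mul_of_nonneg_left ?_ hM0
  rw [filter_snd_eq (p := fun k : Fin 3 → Fin K => ¬ IsDeep K (depth Q (R₁ + 1)) k),
    Finset.card_product, Finset.card_univ, Fintype.card_coe]
  push_cast
  refine mul_le_mul_of_nonneg_left ?_ (Nat.cast_nonneg _)
  exact_mod_cast card_not_deep_le K (depth Q (R₁ + 1))

/-- `K³ − 6 D K² ≤ #deep ≤ K³`, real form. [folklore] -/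
theorem card_deep_bounds (D : ℕ) :
    (K : ℝ) ^ 3 - 6 * D * (K : ℝ) ^ 2 ≤ (Nat.card {k : Fin 3 → Fin K // IsDeep K D k} : ℝ) ∧
      (Nat.card {k : Fin 3 → Fin K // IsDeep K D k} : ℝ) ≤ (K : ℝ) ^ 3 := by
  constructor
  · have := (Nat.cast_le (α := ℝ)).2 (card_deep_ge K D)
    push_cast at this
    linarith
  · have h : Nat.card {k : Fin 3 → Fin K // IsDeep K D k} ≤ K ^ 3 := by
      rw [Nat.card_eq_fintype_card]
      calc Fintype.card {k : Fin 3 → Fin K // IsDeep K D k} ≤ Fintype.card (Fin 3 → Fin K) :=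
            Fintype.card_subtype_le _
        _ = K ^ 3 := by rw [Fintype.card_fun, Fintype.card_fin, Fintype.card_fin]
    exact_mod_cast h

/-- `|#deep · T − K³ · T| ≤ 6 D K² |T|`. [folklore] -/
theorem abs_card_deep_mul_sub_le (D : ℕ) (T : ℝ) :
    |(Nat.card {k : Fin 3 → Fin K // IsDeep K D k} : ℝ) * T - (K : ℝ) ^ 3 * T| ≤
      6 * D * (K : ℝ) ^ 2 * |T| := by
  obtain ⟨h1, h2⟩ := card_deep_bounds K D
  rw [← sub_mul, abs_mul]
  refine mul_le_mul_of_nonneg_right ?_ (abs_nonneg T)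
  rw [abs_sub_comm, abs_of_nonneg (by linarith)]
  linarith

end PatternSum

end Summit.AtomisticToContinuum.Crystallization.Theorems.FluxCellKeplerSketchExact

end
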